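import Summits.HodgeConjecture.HodgeConjecture.Theorems.F0P3ClassificationKitV6
import HarnessLib

/-!
# R90-TF §S4 — support: the quasi-split form of record `Φ₃ = splitForm L 3` as an element of `GL₃(L)`

S4 dealer K2E2-plan (g6) cand for `Theorems/R90S4SplitFormGL.lean`.  The S4 local kit of record (`rogawskiLocalKit`, Lines
`R90_S4_LocalKitExportA`) lives over the MATRIX `F0P3InnerFormClassificationV6.splitForm L 3` (anti-diagonal `J`, `J * J = 1`), while the ε-currency
of FILE C (★ `epsLoc L Φ v`, ★ `IsEpsNormPair L Φ v`, ★ `IsTwistedCharLiftWith Φ …`) is parametrised by a `Φ : GL (Fin 3) L` and reads the group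
through `(UnitaryGroup.cmDatum L 3 ↑Φ).Local v`.  `splitFormGL L` is the `GL₃(L)`-element with `↑(splitFormGL L) = splitForm L 3` BY `rfl` AT REDUCIBLE
TRANSPARENCY (an `abbrev` whose `val`∕`inv` are the matrix itself), so `LocalPacketKit L ↑(splitFormGL L) v` and `LocalPacketKit L (splitForm L 3) v`
are the same type for the elaborator and the Lines-C sockets can be stated at the kit of record with `Φ := splitFormGL L`.  No new mathematics.
[cite: Rogawski1990, §12.2 p. 171 (the quasi-split Hermitian form `Φ₃`); §4.10 p. 57]
-/

set_option linter.dupNamespace false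

namespace Summit.HodgeConjecture.HodgeConjecture.R90.S4

open NumberField IsDedekindDomain
open Literature.NumberTheory.Automorphic Literature.NumberTheory.Automorphic.UnitaryGroup
open Summit.HodgeConjecture.HodgeConjecture.Cruxes.H413.F0P3InnerFormClassificationV6 (splitForm)

section Form

variable (L : Type) [Field L]

/-- `J * J = 1` for the anti-diagonal form `J = splitForm L 3`. [cite: Rogawski1990, §12.2 p. 171] -/
theorem splitForm_three_mul_self : splitForm L 3 * splitForm L 3 = 1 := by
  ext i j
  fin_cases i <;> fin_cases j <;>
    simp [Matrix.mul_apply, Fin.sum_univ_three]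

/-- **The quasi-split form of record as a unit**: `splitFormGL L = ⟨J, J, J*J = 1, J*J = 1⟩ : GL (Fin 3) L`, `J = splitForm L 3`.
An `abbrev`, so that `(splitFormGL L : Matrix (Fin 3) (Fin 3) L)` reduces to `splitForm L 3` reducibly. [cite: Rogawski1990, §12.2 p. 171] -/
abbrev splitFormGL : GL (Fin 3) L :=
  ⟨splitForm L 3, splitForm L 3, splitForm_three_mul_self L, splitForm_three_mul_self L⟩

/-- `↑(splitFormGL L) = splitForm L 3` (`rfl`). [cite: Rogawski1990, §12.2 p. 171] -/
@[simp] theorem coe_splitFormGL : (splitFormGL L : Matrix (Fin 3) (Fin 3) L) = splitForm L 3 := rfl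

/-- `↑(splitFormGL L)⁻¹ = splitForm L 3` (`rfl`: `J⁻¹ = J`). [cite: Rogawski1990, §12.2 p. 171] -/
@[simp] theorem coe_inv_splitFormGL : (((splitFormGL L)⁻¹ : GL (Fin 3) L) : Matrix (Fin 3) (Fin 3) L) = splitForm L 3 := rfl

/-- `splitFormGL L * splitFormGL L = 1` in `GL₃(L)`. [cite: Rogawski1990, §12.2 p. 171] -/
theorem splitFormGL_mul_self : splitFormGL L * splitFormGL L = 1 :=
  Units.ext (splitForm_three_mul_self L)

end Form

section Datum

variable (L : Type) [Field L] [NumberField L] [IsCMField L]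

/-- The identification used by the Lines-C sockets holds at REDUCIBLE transparency: the `cmDatum` of `↑(splitFormGL L)` IS the `cmDatum` of
`splitForm L 3` (so `rogawskiLocalKit … : LocalPacketKit L (splitForm L 3) v` elaborates where `LocalPacketKit L ↑(splitFormGL L) v` is expected).
[cite: Rogawski1990, §12.2 p. 171] -/
theorem cmDatum_splitFormGL :
    UnitaryGroup.cmDatum L 3 (splitFormGL L : Matrix (Fin 3) (Fin 3) L) = UnitaryGroup.cmDatum L 3 (splitForm L 3) := by
  with_reducible rfl

end Datum

end Summit.HodgeConjecture.HodgeConjecture.R90.S4
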